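import Literature.NumberTheory.DiophantineApproximation.PolylogTwoPointHermitePade
import Literature.NumberTheory.DiophantineApproximation.PolylogHermitePadeBounds
import HarnessLib

/-!
# Type-I Hermite–Padé forms for `1, Li_s(1/N), Li_s(−1/N)`: vanishing, positivity and size of the parity kernel

Topic `Literature/NumberTheory/DiophantineApproximation`. Elementary facts about the weight-`w`
PARITY kernel `K^{(w)}_n(u) = 4^{wn} (u − wn + 1)_{wn} / (2u + 1)_{n+1}^w` (`ParityPade.kernelH`) and
the parity form `Λ^{(w)}_n(y) = ∑_{u ≥ 0} K^{(w)}_n(u) y^{u+1}` (`ParityPade.formH`) of the sibling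
vocabulary file `PolylogTwoPointHermitePade.lean` (David–Hirata-Kohno–Kawashima 2020, Thm 2.1, at the
two points `±1/N`), the two-point analogue of `PolylogHermitePadeBounds.lean`. The numerator
`(u − wn + 1)_{wn}` is literally the numerator of the one-point kernel `PolylogPade.kernelW`, so its
vanishing / positivity / size at the naturals are imported (`PolylogPade.pochNum_natCast_eq_zero`,
`PolylogPade.pochNum_natCast_pos`, `PolylogPade.pochNum_natCast_le_pow`, `PolylogPade.pochNum_self`);
only the denominator `(2u + 1)_{n+1}` (the one-point denominator `(t + 1)_{n+1}` at the doubled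
variable `t = 2u`) and the constant `4^{wn}` change:

* `kernelH_natCast_eq_zero` — the kernel vanishes at the naturals `u < wn`;
* `pochDenTwo_pos`, `pow_le_pochDenTwo_pow`, `kernelH_natCast_pos`, `kernelH_natCast_nonneg`,
  `kernelH_natCast_le` — for naturals `u ≥ wn`,
  `0 < (u − wn + 1)_{wn} ≤ (u+1)^{wn} ≤ (2u+1)^{wn} ≤ (2u+1)_{n+1}^w`, whence
  `0 < K^{(w)}_n(u) ≤ 4^{wn}`; together with the vanishing, `0 ≤ K^{(w)}_n(u) ≤ 4^{wn}` at every
  natural `u`;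
* `pochDenTwo_self_mul_factorial`, `kernelH_self` — the first nonzero coefficient
  `K^{(w)}_n(wn) = 4^{wn} (wn)! / ((2wn+1)(2wn+2)⋯((2w+1)n+1))^w = 4^{wn} (wn)! (2wn)!^w / ((2w+1)n+1)!^w`;
* `summable_formH`, `formH_pos`, `formH_le_div`, `formH_le`, `formH_ge` — for `0 ≤ y < 1` the series
  converges (comparison with `4^{wn}` times the geometric series), `0 < Λ^{(w)}_n(y)` for `0 < y`,
  `Λ^{(w)}_n(y) ≤ 4^{wn} y^{wn+1}/(1 − y)` (only the terms `u ≥ wn` survive and `K ≤ 4^{wn}`), hence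
  `Λ^{(w)}_n(y) ≤ 4^{wn} y^{wn} = (4y)^{wn}` for `y ≤ 1/2`, and
  `Λ^{(w)}_n(y) ≥ K^{(w)}_n(wn) y^{wn+1} = 4^{wn} (wn)! (2wn)!^w/((2w+1)n+1)!^w · y^{wn+1}`
  (all terms are `≥ 0`).

With `y = 1/M`, `M = N²`, these give `0 < Λ^{(w)}_n(1/M) ≤ (4/M)^{wn}`, the "analytic half" of the
linear independence argument for `1, Li_s(1/M), Θ_s(1/M)` (`s ≤ w`). Everything is proved from Mathlib
and the one-point file; no definitions, no named facts.
-/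

noncomputable section

open Finset

namespace Literature.NumberTheory.DiophantineApproximation

namespace ParityPade

open Literature.NumberTheory.Transcendental

/-! ## The denominator at naturals -/

/-- The denominator base `(2u + 1)_{n+1} = ∏_{s ≤ n} (2u + 1 + s)` is positive at every natural `u`
(the one-point denominator `PolylogPade.pochDen_pos` at `t = 2u`). [folklore] -/
theorem pochDenTwo_pos (n u : ℕ) : 0 < BallRivoal.poch (2 * (u : ℚ) + 1) (n + 1) := by
  have h := PolylogPade.pochDen_pos n (2 * u)
  push_cast at h
  exact h

/-- At every natural `u` the denominator dominates:
`(2u + 1)^{wn} ≤ (2u + 1)^{w(n+1)} ≤ (2u + 1)_{n+1}^w` (the one-point `PolylogPade.pow_le_pochDen_pow`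
at `t = 2u`). [folklore] -/
theorem pow_le_pochDenTwo_pow (w n u : ℕ) :
    (2 * (u : ℚ) + 1) ^ (w * n) ≤ BallRivoal.poch (2 * (u : ℚ) + 1) (n + 1) ^ w := by
  have h := PolylogPade.pow_le_pochDen_pow w n (2 * u)
  push_cast at h
  exact h

/-! ## The kernel at naturals -/

/-- The parity kernel `K^{(w)}_n(u)` vanishes at the naturals `u < wn` (its numerator
`(u − wn + 1)_{wn}` does): the series `Λ^{(w)}_n(y)` starts at `y^{wn+1}`.
[cite: DavidHirataKohnoKawashima2020, Thm 2.1] -/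
theorem kernelH_natCast_eq_zero {w n u : ℕ} (hu : u < w * n) : kernelH w n u = 0 := by
  rw [kernelH, PolylogPade.pochNum_natCast_eq_zero hu, mul_zero, zero_div]

/-- The parity kernel `K^{(w)}_n(u)` is positive at the naturals `u ≥ wn`.
[cite: DavidHirataKohnoKawashima2020, Thm 2.1] -/
theorem kernelH_natCast_pos {w n u : ℕ} (hu : w * n ≤ u) : 0 < kernelH w n u := by
  unfold kernelH
  exact div_pos (mul_pos (pow_pos (by norm_num) _) (PolylogPade.pochNum_natCast_pos hu))
    (pow_pos (pochDenTwo_pos n u) w)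

/-- The parity kernel `K^{(w)}_n(u)` is nonnegative at every natural `u`.
[cite: DavidHirataKohnoKawashima2020, Thm 2.1] -/
theorem kernelH_natCast_nonneg (w n u : ℕ) : 0 ≤ kernelH w n u := by
  rcases lt_or_ge u (w * n) with h | h
  · rw [kernelH_natCast_eq_zero h]
  · exact (kernelH_natCast_pos h).le

/-- The parity kernel satisfies `K^{(w)}_n(u) ≤ 4^{wn}` at every natural `u`
(`0 ≤ num ≤ (u+1)^{wn} ≤ (2u+1)^{wn} ≤ den` for `u ≥ wn`, and `K^{(w)}_n(u) = 0` for `u < wn`).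
[cite: DavidHirataKohnoKawashima2020, Thm 2.1] -/
theorem kernelH_natCast_le (w n u : ℕ) : kernelH w n u ≤ 4 ^ (w * n) := by
  rcases lt_or_ge u (w * n) with h | h
  · rw [kernelH_natCast_eq_zero h]
    positivity
  · unfold kernelH
    rw [div_le_iff₀ (pow_pos (pochDenTwo_pos n u) w)]
    refine mul_le_mul_of_nonneg_left ?_ (by positivity)
    have hu1 : (u : ℚ) + 1 ≤ 2 * (u : ℚ) + 1 := by
      have := (u.cast_nonneg : (0 : ℚ) ≤ u)
      linarith
    calc BallRivoal.poch ((u : ℚ) - w * n + 1) (w * n) ≤ ((u : ℚ) + 1) ^ (w * n) :=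
          PolylogPade.pochNum_natCast_le_pow h
      _ ≤ (2 * (u : ℚ) + 1) ^ (w * n) := pow_le_pow_left₀ (by positivity) hu1 _
      _ ≤ BallRivoal.poch (2 * (u : ℚ) + 1) (n + 1) ^ w := pow_le_pochDenTwo_pow w n u

/-- `0 ≤ K^{(w)}_n(u)` at every natural `u`, as a real number (cast of `kernelH_natCast_nonneg`).
[cite: DavidHirataKohnoKawashima2020, Thm 2.1] -/
theorem kernelH_realCast_nonneg (w n u : ℕ) : (0 : ℝ) ≤ (kernelH w n (u : ℚ) : ℝ) := by
  exact_mod_cast kernelH_natCast_nonneg w n u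

/-- `K^{(w)}_n(u) ≤ 4^{wn}` at every natural `u`, as a real number (cast of `kernelH_natCast_le`):
the coefficients of `Λ^{(w)}_n` are bounded, so the series converges absolutely for `|y| < 1`.
[cite: DavidHirataKohnoKawashima2020, Thm 2.1] -/
theorem kernelH_realCast_le (w n u : ℕ) : (kernelH w n u : ℝ) ≤ 4 ^ (w * n) := by
  exact_mod_cast kernelH_natCast_le w n u

/-! ## The first nonzero coefficient -/

/-- `(2wn + 1)_{n+1} · (2wn)! = ((2w+1)n + 1)!` (Mathlib's `Nat.factorial_mul_ascFactorial`).
[folklore] -/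
theorem pochDenTwo_self_mul_factorial (w n : ℕ) :
    BallRivoal.poch (2 * ((w * n : ℕ) : ℚ) + 1) (n + 1) * ((2 * w * n).factorial : ℚ) =
      ((((2 * w + 1) * n + 1).factorial : ℚ)) := by
  have h := Nat.factorial_mul_ascFactorial (2 * w * n) (n + 1)
  rw [Nat.ascFactorial_eq_prod_range, show 2 * w * n + (n + 1) = (2 * w + 1) * n + 1 by ring] at h
  rw [mul_comm]
  unfold BallRivoal.poch
  have h' : ∀ s ∈ range (n + 1),
      (2 * ((w * n : ℕ) : ℚ) + 1 + (s : ℚ)) = ((2 * w * n + 1 + s : ℕ) : ℚ) := by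
    intro s _
    push_cast
    ring
  rw [Finset.prod_congr rfl h', ← Nat.cast_prod]
  exact_mod_cast h

/-- **The first nonzero coefficient of `Λ^{(w)}_n`**:
`K^{(w)}_n(wn) = 4^{wn} (wn)! / ((2wn+1)(2wn+2)⋯((2w+1)n+1))^w = 4^{wn} (wn)! (2wn)!^w / ((2w+1)n+1)!^w`.
[cite: DavidHirataKohnoKawashima2020, Thm 2.1] -/
theorem kernelH_self (w n : ℕ) :
    kernelH w n ((w * n : ℕ) : ℚ) =
      4 ^ (w * n) * ((w * n).factorial : ℚ) * (((2 * w * n).factorial : ℚ) ^ w) /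
        ((((2 * w + 1) * n + 1).factorial : ℚ) ^ w) := by
  have hP : 0 < BallRivoal.poch (2 * ((w * n : ℕ) : ℚ) + 1) (n + 1) := pochDenTwo_pos n (w * n)
  have hf : (0 : ℚ) < (2 * w * n).factorial := by exact_mod_cast Nat.factorial_pos _
  rw [kernelH, PolylogPade.pochNum_self, ← pochDenTwo_self_mul_factorial,
    div_eq_div_iff (pow_ne_zero _ hP.ne') (pow_ne_zero _ (mul_ne_zero hP.ne' hf.ne'))]
  ring

/-! ## Convergence and the two-sided bounds for `Λ^{(w)}_n(y)` -/

/-- For `0 ≤ y < 1` the series `Λ^{(w)}_n(y) = ∑_{u ≥ 0} K^{(w)}_n(u) y^{u+1}` converges (its terms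
lie between `0` and `4^{wn}` times those of the geometric series).
[cite: DavidHirataKohnoKawashima2020, Thm 2.1] -/
theorem summable_formH (w n : ℕ) {y : ℝ} (hy : 0 ≤ y) (hy1 : y < 1) :
    Summable fun u : ℕ => (kernelH w n (u : ℚ) : ℝ) * y ^ (u + 1) := by
  have hg : Summable fun u : ℕ => (4 : ℝ) ^ (w * n) * y ^ (u + 1) := by
    refine ((summable_geometric_of_lt_one hy hy1).mul_left ((4 : ℝ) ^ (w * n) * y)).congr
      fun u => ?_
    ring
  refine Summable.of_nonneg_of_le (fun u => ?_) (fun u => ?_) hg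
  · exact mul_nonneg (kernelH_realCast_nonneg w n u) (pow_nonneg hy _)
  · exact mul_le_mul_of_nonneg_right (kernelH_realCast_le w n u) (pow_nonneg hy _)

/-- **Positivity**: `0 < Λ^{(w)}_n(y)` for `0 < y < 1` (all terms are `≥ 0` and the term `u = wn`
is `> 0`). [cite: DavidHirataKohnoKawashima2020, Thm 2.1] -/
theorem formH_pos (w n : ℕ) {y : ℝ} (hy : 0 < y) (hy1 : y < 1) : 0 < formH w n y := by
  unfold formH
  have hwn : (0 : ℝ) < (kernelH w n ((w * n : ℕ) : ℚ) : ℝ) := by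
    exact_mod_cast kernelH_natCast_pos le_rfl
  exact (summable_formH w n hy.le hy1).tsum_pos
    (fun u => mul_nonneg (kernelH_realCast_nonneg w n u) (pow_nonneg hy.le _)) (w * n)
    (mul_pos hwn (pow_pos hy _))

/-- **Tail bound**: `Λ^{(w)}_n(y) ≤ 4^{wn} y^{wn+1} / (1 − y)` for `0 ≤ y < 1` (the terms `u < wn`
vanish and `0 ≤ K^{(w)}_n(u) ≤ 4^{wn}` for the others, so `Λ^{(w)}_n(y) ≤ 4^{wn} ∑_{u ≥ wn} y^{u+1}`).
[cite: DavidHirataKohnoKawashima2020, Thm 2.1] -/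
theorem formH_le_div (w n : ℕ) {y : ℝ} (hy : 0 ≤ y) (hy1 : y < 1) :
    formH w n y ≤ 4 ^ (w * n) * y ^ (w * n + 1) / (1 - y) := by
  have hs := summable_formH w n hy hy1
  have h0 : ∑ u ∈ range (w * n), (kernelH w n u : ℝ) * y ^ (u + 1) = 0 :=
    Finset.sum_eq_zero fun u hu => by
      rw [kernelH_natCast_eq_zero (Finset.mem_range.1 hu), Rat.cast_zero, zero_mul]
  have hs' : Summable fun u : ℕ =>
      (kernelH w n ((u + w * n : ℕ) : ℚ) : ℝ) * y ^ (u + w * n + 1) :=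
    (summable_nat_add_iff (f := fun u : ℕ => (kernelH w n u : ℝ) * y ^ (u + 1)) (w * n)).2 hs
  have hg : Summable fun u : ℕ => 4 ^ (w * n) * y ^ (w * n + 1) * y ^ u :=
    (summable_geometric_of_lt_one hy hy1).mul_left _
  unfold formH
  rw [← hs.sum_add_tsum_nat_add (w * n), h0, zero_add]
  calc ∑' u : ℕ, (kernelH w n ((u + w * n : ℕ) : ℚ) : ℝ) * y ^ (u + w * n + 1)
      ≤ ∑' u : ℕ, 4 ^ (w * n) * y ^ (w * n + 1) * y ^ u := by
        refine hs'.tsum_le_tsum (fun u => ?_) hg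
        calc (kernelH w n ((u + w * n : ℕ) : ℚ) : ℝ) * y ^ (u + w * n + 1)
            ≤ 4 ^ (w * n) * y ^ (u + w * n + 1) :=
              mul_le_mul_of_nonneg_right (kernelH_realCast_le w n (u + w * n)) (pow_nonneg hy _)
          _ = 4 ^ (w * n) * y ^ (w * n + 1) * y ^ u := by ring
    _ = 4 ^ (w * n) * y ^ (w * n + 1) / (1 - y) := by
        rw [tsum_mul_left, tsum_geometric_of_lt_one hy hy1, div_eq_mul_inv]

/-- **Upper bound**: `Λ^{(w)}_n(y) ≤ 4^{wn} y^{wn} = (4y)^{wn}` for `0 ≤ y ≤ 1/2`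
(`Λ^{(w)}_n(y) ≤ 4^{wn} y^{wn+1}/(1 − y) ≤ 4^{wn} y^{wn}` as `y ≤ 1 − y`); at `y = 1/M`, `M ≥ 2`,
this is `Λ^{(w)}_n(1/M) ≤ (4/M)^{wn}`. [cite: DavidHirataKohnoKawashima2020, Thm 2.1] -/
theorem formH_le (w n : ℕ) {y : ℝ} (hy : 0 ≤ y) (hy1 : y ≤ 1 / 2) :
    formH w n y ≤ 4 ^ (w * n) * y ^ (w * n) := by
  have hy1' : y < 1 := by linarith
  refine (formH_le_div w n hy hy1').trans ?_
  rw [div_le_iff₀ (by linarith), pow_succ, ← mul_assoc]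
  exact mul_le_mul_of_nonneg_left (by linarith) (by positivity)

/-- **Lower bound**:
`Λ^{(w)}_n(y) ≥ K^{(w)}_n(wn) y^{wn+1} = 4^{wn} (wn)! (2wn)!^w/((2w+1)n+1)!^w · y^{wn+1}` for
`0 ≤ y < 1` (all terms are nonnegative; keep the first nonzero one).
[cite: DavidHirataKohnoKawashima2020, Thm 2.1] -/
theorem formH_ge (w n : ℕ) {y : ℝ} (hy : 0 ≤ y) (hy1 : y < 1) :
    4 ^ (w * n) * ((w * n).factorial : ℝ) * (((2 * w * n).factorial : ℝ) ^ w) /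
        ((((2 * w + 1) * n + 1).factorial : ℝ) ^ w) * y ^ (w * n + 1) ≤ formH w n y := by
  have h : (kernelH w n ((w * n : ℕ) : ℚ) : ℝ) =
      4 ^ (w * n) * ((w * n).factorial : ℝ) * (((2 * w * n).factorial : ℝ) ^ w) /
        ((((2 * w + 1) * n + 1).factorial : ℝ) ^ w) := by
    rw [kernelH_self]
    push_cast
    rfl
  rw [formH, ← h]
  exact (summable_formH w n hy hy1).le_tsum (w * n) fun u _ =>
    mul_nonneg (kernelH_realCast_nonneg w n u) (pow_nonneg hy _)

end ParityPade

end Literature.NumberTheory.DiophantineApproximation
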